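import Summits.CriticalPhenomena.PercolationContinuityZ3.Theorems.SahiPositivityWeakLimits

/-!
# Sahi positivity of order `n` is weakly closed: the unit cube `Q_d` and `ℝ^d`

Support file of the Sahi cell (`prim-sahi`, typer seat, generation 14; `--supports stmt-CriticalPhenomena-4575`).
Theorems only (no definitions, no named facts, no sorries).  Instances of `SahiPositivityWeakLimits.lean`
(continuous monotone test families suffice; weak limits of order-`n` Sahi-positive laws are order-`n`
Sahi-positive) for the unit cube `Q_d = (Fin d → [0,1])` — where monotone functions are automatically bounded, so
the conclusion is for ALL measurable nonnegative monotone families — and for `ℝ^d` (bounded families); both are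
finite products of (R1) metric chains, Polish, so every finite Borel measure is inner regular by compact sets.

* `msahiE_nonneg_of_continuous_cube`, `msahiE_nonneg_of_tendsto_cube`, `msahiE_nonneg_of_tendsto_cube'`;
* `msahiE_nonneg_of_continuous_real`, `msahiE_nonneg_of_tendsto_real`.

No sorries, no new axioms.
-/

noncomputable section

namespace Summit.CriticalPhenomena.PercolationContinuityZ3.Theorems.SahiWeakLimits

open MeasureTheory Set Filter Topology Function Literature.Combinatorics.Sahi2008
open scoped ENNReal unitInterval

/-! ### The unit cube `Q_d` and `ℝ^d` -/

section Instances

variable {d n : ℕ} {ι : Type*} {L : Filter ι} [NeBot L]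

/-- **`Q_d = [0,1]^d`: continuous monotone test families suffice** — a finite measure on the unit cube with
`E_n ≥ 0` on continuous monotone `[0,1]`-valued families has `E_n ≥ 0` on ALL measurable nonnegative monotone
families (monotone functions on `Q_d` are bounded by their value at the top corner). [this work] -/
theorem msahiE_nonneg_of_continuous_cube (μ : Measure (Fin d → I)) [IsFiniteMeasure μ]
    (h : ∀ g : Fin n → (Fin d → I) → ℝ, (∀ i, Continuous (g i)) → (∀ i, Monotone (g i)) →
      (∀ i x, 0 ≤ g i x) → (∀ i x, g i x ≤ 1) → 0 ≤ msahiE μ n g)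
    (f : Fin n → (Fin d → I) → ℝ) (hfm : ∀ i, Measurable (f i)) (hf0 : ∀ i x, 0 ≤ f i x)
    (hmono : ∀ i, Monotone (f i)) : 0 ≤ msahiE μ n f := by
  refine msahiE_nonneg_of_continuous (F := fun _ : Fin d => I) (fun _ a b c hca => subtype_dist_sup_le a b c hca)
    μ h f hfm hf0 (B := ∑ j, f j fun _ => 1) (fun i x => ?_) hmono
  exact (hmono i fun k => unitInterval.le_one (x k)).trans
    (Finset.single_le_sum (fun j _ => hf0 j _) (Finset.mem_univ i))

/-- **`Q_d`: weak limits of order-`n` Sahi-positive probability measures are order-`n` Sahi-positive** (for all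
measurable nonnegative monotone families). [this work] -/
theorem msahiE_nonneg_of_tendsto_cube {μs : ι → ProbabilityMeasure (Fin d → I)}
    {μ : ProbabilityMeasure (Fin d → I)} (hconv : Tendsto μs L (𝓝 μ))
    (h : ∀ᶠ k in L, ∀ g : Fin n → (Fin d → I) → ℝ, (∀ i, Continuous (g i)) → (∀ i, Monotone (g i)) →
      (∀ i x, 0 ≤ g i x) → (∀ i x, g i x ≤ 1) → 0 ≤ msahiE (μs k : Measure (Fin d → I)) n g)
    (f : Fin n → (Fin d → I) → ℝ) (hfm : ∀ i, Measurable (f i)) (hf0 : ∀ i x, 0 ≤ f i x)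
    (hmono : ∀ i, Monotone (f i)) : 0 ≤ msahiE (μ : Measure (Fin d → I)) n f :=
  msahiE_nonneg_of_continuous_cube (μ : Measure (Fin d → I))
    (fun g hgc hgm hg0 hg1 => msahiE_nonneg_of_tendsto_probabilityMeasure hconv g hgc
      (fun i => ⟨1, fun x => by rw [abs_of_nonneg (hg0 i x)]; exact hg1 i x⟩)
      (h.mono fun k hk => hk g hgc hgm hg0 hg1))
    f hfm hf0 hmono

/-- The same with the weaker hypothesis that each `μ_k` is Sahi-positive of order `n` on all MEASURABLE
nonnegative monotone families (e.g. the conclusion of the cell's box-TP₂ theorems). [this work] -/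
theorem msahiE_nonneg_of_tendsto_cube' {μs : ι → ProbabilityMeasure (Fin d → I)}
    {μ : ProbabilityMeasure (Fin d → I)} (hconv : Tendsto μs L (𝓝 μ))
    (h : ∀ᶠ k in L, ∀ g : Fin n → (Fin d → I) → ℝ, (∀ i, Measurable (g i)) → (∀ i, Monotone (g i)) →
      (∀ i x, 0 ≤ g i x) → 0 ≤ msahiE (μs k : Measure (Fin d → I)) n g)
    (f : Fin n → (Fin d → I) → ℝ) (hfm : ∀ i, Measurable (f i)) (hf0 : ∀ i x, 0 ≤ f i x)
    (hmono : ∀ i, Monotone (f i)) : 0 ≤ msahiE (μ : Measure (Fin d → I)) n f :=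
  msahiE_nonneg_of_tendsto_cube hconv
    (h.mono fun _ hk g hgc hgm hg0 _ => hk g (fun i => (hgc i).measurable) hgm hg0) f hfm hf0 hmono

/-- **`ℝ^d`: continuous monotone test families suffice** (bounded measurable monotone families). [this work] -/
theorem msahiE_nonneg_of_continuous_real (μ : Measure (Fin d → ℝ)) [IsFiniteMeasure μ]
    (h : ∀ g : Fin n → (Fin d → ℝ) → ℝ, (∀ i, Continuous (g i)) → (∀ i, Monotone (g i)) →
      (∀ i x, 0 ≤ g i x) → (∀ i x, g i x ≤ 1) → 0 ≤ msahiE μ n g)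
    (f : Fin n → (Fin d → ℝ) → ℝ) (hfm : ∀ i, Measurable (f i)) (hf0 : ∀ i x, 0 ≤ f i x) {B : ℝ}
    (hfB : ∀ i x, f i x ≤ B) (hmono : ∀ i, Monotone (f i)) : 0 ≤ msahiE μ n f :=
  msahiE_nonneg_of_continuous (F := fun _ : Fin d => ℝ) (fun _ a b c hca => real_dist_sup_le a b c hca)
    μ h f hfm hf0 hfB hmono

/-- **`ℝ^d`: weak limits of order-`n` Sahi-positive probability measures are order-`n` Sahi-positive** (bounded
measurable nonnegative monotone families). [this work] -/
theorem msahiE_nonneg_of_tendsto_real {μs : ι → ProbabilityMeasure (Fin d → ℝ)}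
    {μ : ProbabilityMeasure (Fin d → ℝ)} (hconv : Tendsto μs L (𝓝 μ))
    (h : ∀ᶠ k in L, ∀ g : Fin n → (Fin d → ℝ) → ℝ, (∀ i, Continuous (g i)) → (∀ i, Monotone (g i)) →
      (∀ i x, 0 ≤ g i x) → (∀ i x, g i x ≤ 1) → 0 ≤ msahiE (μs k : Measure (Fin d → ℝ)) n g)
    (f : Fin n → (Fin d → ℝ) → ℝ) (hfm : ∀ i, Measurable (f i)) (hf0 : ∀ i x, 0 ≤ f i x) {B : ℝ}
    (hfB : ∀ i x, f i x ≤ B) (hmono : ∀ i, Monotone (f i)) : 0 ≤ msahiE (μ : Measure (Fin d → ℝ)) n f :=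
  msahiE_nonneg_of_continuous_real (μ : Measure (Fin d → ℝ))
    (fun g hgc hgm hg0 hg1 => msahiE_nonneg_of_tendsto_probabilityMeasure hconv g hgc
      (fun i => ⟨1, fun x => by rw [abs_of_nonneg (hg0 i x)]; exact hg1 i x⟩)
      (h.mono fun k hk => hk g hgc hgm hg0 hg1))
    f hfm hf0 hfB hmono

end Instances

end Summit.CriticalPhenomena.PercolationContinuityZ3.Theorems.SahiWeakLimits
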